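import Summits.QuantumFields.BalabanUV.Beta.GAN24.CapacitanceSolve

/-!
# `BalabanUV.Beta.GAN24.CapacitanceSolveZero` — binder row G-an2-4 / (CONV-C), road P1-fibre, leaf P1-L05 part (a′): the `p = 0` FIBRE of the arrow system
# (SKELETON-P1 S1b: «at p = 0 the m = 0 block T(0) = 0 is singular and the roles swap (the border pins the zero modes)»), `L04c`-independent algebra

NOT IN PRINT; OUR PROOF ATTEMPT.  HONEST FRAMING (cell contract, verbatim): «discharging `BetaPertH` makes Bałaban's UV stability UNCONDITIONAL — a real
constructive-QFT result; it is NOT the continuum limit and NOT the Clay problem.»  HONEST DEPENDENCY (verbatim): «continuum YM on T⁴ ⇐ BetaPertH ∧ nine spine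
estimates (0/9 proved); BetaPertH ⇐ (D1) ∧ (D4) ∧ CAP+tail; G-an2-4 gates asym, D1 and NE2/3/4.»  [folklore] finite-dimensional algebra over `ℂ` (no estimate, no cited
fact, no wall binder, no `def … : Prop` hypothesis: the `[shape]` predicate carries all its data as parameters and is asserted of nothing).  NOT summit progress;
nothing of (CONV-C)'s K-slot is discharged here.

## What is proved
Companion of `GAN24/CapacitanceSolve` (the `p ≠ 0` fibres: arrow system ⇔ `(D+1)×(D+1)` capacitance system).  At coarse momentum `p = 0` the alias `m = 0` has
fine momentum `k_0 = 0`, so `∂̂(k_0) = ∂̂♭(k_0) = 0`, `L_0 = 0`, and `CapacitanceSolve.Fibre` (all `L_m ≠ 0`) covers only the NONZERO aliases.  The zero alias's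
(EL) rows collapse to `−wE⁰_κ φ_κ = f⁰_κ` and its (G) row to `−wG⁰ c = γ⁰` (in S1a: `wE⁰_κ = χ̂(0)s♭_κ(0) = N`, `wG⁰ = χ̂(0) = 1`, `wM⁰ = S(0) = N^D`,
`wQ⁰_κ = S(0)s_κ(0) = N^{D+1}` — all nonzero: `Fibre0`), which determine `(φ, c)` OUTRIGHT (`phi0`, `cee0`); the nonzero aliases are then solved by
`FibreBlockSolve.Asol`/`musol` with these feeds (`CapacitanceSolve.Ablk`/`mublk` BY NAME), and the zero alias's own unknowns `(A⁰, μ⁰)` — which enter ONLY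
the (M)/(Q) rows — are read off those rows (`Azero`, `muzero`).  THEOREM `arrowSolves0_iff`: the `p = 0` arrow system (`ArrowSolves0`) is solved by
`(A, μ, A⁰, μ⁰, φ, c)` iff it is this explicit tuple — EXPLICITLY AND UNIQUELY SOLVABLE WITH NO `(D+1)×(D+1)` INVERSE; `wQ0_mul_Azero`/`wM0_mul_muzero` express
`(A⁰, μ⁰)` through the same alias sums `capP`, `capV`, `capW`, `srcQ`, `srcM` as at `p ≠ 0`.  This is the variant recorded in leaf P1-L05 as «the p = 0 variant
(m = 0 block pinned by the Q/M rows, c = 0)» (`c = cee0 = 0` for a source-free G row).  Part (b) of the leaf (the concrete weights from L04c/L06, `Cap N p`,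
`arrowMat_inv_apply`) is NOT done here.
-/

open Finset
open scoped BigOperators

namespace Summit.QuantumFields.BalabanUV.Beta.GAN24.CapacitanceSolveZero

open FibreBlockSolve (dot Asol musol)
open CapacitanceSolve

variable {D : ℕ} {ι : Type*}

/-! ## The zero-momentum fibre
At coarse momentum `p = 0` the alias `m = 0` has fine momentum `k_0 = 0`, so `∂̂(k_0) = ∂̂♭(k_0) = 0`, `L_0 = 0`: its (EL) rows collapse to `−wE⁰_κ φ_κ = f⁰_κ` and its
(G) row to `−wG⁰ c = γ⁰` (in S1a: `wE⁰_κ = χ̂(0)s♭_κ(0) = N`, `wG⁰ = χ̂(0) = 1`, `wM⁰ = S(0) = N^D`, `wQ⁰_κ = S(0)s_κ(0) = N^{D+1}` — all nonzero), which determine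
`(φ, c)` OUTRIGHT; the nonzero aliases are then solved by `Asol`/`musol` with these feeds, and the zero block's own unknowns `(A⁰, μ⁰)` — which enter ONLY the
(M)/(Q) rows — are read off those rows.  So the `p = 0` fibre is explicitly and uniquely solvable (`arrowSolves0_iff`), with NO `(D+1)×(D+1)` inverse: the variant
recorded in leaf P1-L05 as «the m = 0 block pinned by the Q/M rows, c = 0 (for γ⁰ = 0)». -/

/-- [folklore] `p = 0` FIBRE DATA: the nonzero aliases `F : Fibre D ι` (all `L_m ≠ 0`) plus the border weights of the degenerate zero alias, all nonzero. -/
structure Fibre0 (D : ℕ) (ι : Type*) extends Fibre D ι where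
  /-- EL-row border weight of the zero alias (S1a at `p = 0`: `χ̂(0)s♭_κ(0) = N`) -/
  wE0 : Fin D → ℂ
  /-- G-row border weight of the zero alias (S1a: `χ̂(0) = 1`) -/
  wG0 : ℂ
  /-- M-row weight of the zero alias (S1a: `S(0) = N^D`) -/
  wM0 : ℂ
  /-- Q-row weight of the zero alias (S1a: `S(0)s_κ(0) = N^{D+1}`) -/
  wQ0 : Fin D → ℂ
  /-- nondegeneracy of the pinning rows -/
  wE0_ne : ∀ κ, wE0 κ ≠ 0
  /-- nondegeneracy of the pinning rows -/
  wG0_ne : wG0 ≠ 0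
  /-- nondegeneracy of the pinning rows -/
  wM0_ne : wM0 ≠ 0
  /-- nondegeneracy of the pinning rows -/
  wQ0_ne : ∀ κ, wQ0 κ ≠ 0

variable (F0 : Fibre0 D ι)

/-- [shape] THE `p = 0` ARROW SYSTEM: nonzero-alias (EL)/(G) rows as before; zero-alias rows `−wE⁰_κ φ_κ = f⁰_κ`, `−wG⁰ c = γ⁰`; the (M)/(Q) rows now also
carry the zero alias's `μ⁰`, `A⁰`.  Asserted of nothing. -/
def ArrowSolves0 [Fintype ι] (f : ι → Fin D → ℂ) (γ : ι → ℂ) (f0 : Fin D → ℂ) (γ0 ρ : ℂ) (q : Fin D → ℂ)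
    (A : ι → Fin D → ℂ) (μ : ι → ℂ) (A0 : Fin D → ℂ) (μ0 : ℂ) (φ : Fin D → ℂ) (c : ℂ) : Prop :=
  ELRows F0.toFibre f A μ φ ∧ GRows F0.toFibre γ A c ∧ (∀ κ, -(F0.wE0 κ * φ κ) = f0 κ) ∧ -(F0.wG0 * c) = γ0 ∧
    F0.wM0 * μ0 + ∑ m, F0.wM m * μ m = ρ ∧ ∀ κ, F0.wQ0 κ * A0 κ + ∑ m, F0.wQ m κ * A m κ = q κ

/-- [folklore] The pinned constraint multiplier at `p = 0`: `φ_κ = −f⁰_κ / wE⁰_κ`. -/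
noncomputable def phi0 (f0 : Fin D → ℂ) : Fin D → ℂ := fun κ => -f0 κ / F0.wE0 κ

/-- [folklore] The pinned block gauge constant at `p = 0`: `c = −γ⁰ / wG⁰` (`= 0` for a source-free G row). -/
noncomputable def cee0 (γ0 : ℂ) : ℂ := -γ0 / F0.wG0

/-- [folklore] The zero alias's field, read off the Q rows: `A⁰_κ = (q_κ − Σ_m wQ_{mκ} (A_m)_κ)/wQ⁰_κ` with `A_m` the `Asol`-blocks fed by `(phi0, cee0)`. -/
noncomputable def Azero [Fintype ι] (f : ι → Fin D → ℂ) (γ : ι → ℂ) (f0 : Fin D → ℂ) (γ0 : ℂ) (q : Fin D → ℂ) : Fin D → ℂ :=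
  fun κ => (q κ - ∑ m, F0.wQ m κ * Ablk F0.toFibre f γ (phi0 F0 f0) (cee0 F0 γ0) m κ) / F0.wQ0 κ

/-- [folklore] The zero alias's gauge multiplier, read off the M row: `μ⁰ = (ρ − Σ_m wM_m μ_m)/wM⁰`. -/
noncomputable def muzero [Fintype ι] (f : ι → Fin D → ℂ) (f0 : Fin D → ℂ) (ρ : ℂ) : ℂ :=
  (ρ - ∑ m, F0.wM m * mublk F0.toFibre f (phi0 F0 f0) m) / F0.wM0

/-- [folklore] **THE `p = 0` FIBRE IS EXPLICITLY AND UNIQUELY SOLVABLE**: `(A, μ, A⁰, μ⁰, φ, c)` solves the `p = 0` arrow system iff it is the explicit tuple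
`(Ablk, mublk, Azero, muzero, phi0, cee0)` — the border pins `(φ, c)`, `FibreBlockSolve` gives the nonzero aliases, the (Q)/(M) rows give the zero alias. -/
theorem arrowSolves0_iff [Fintype ι] (f : ι → Fin D → ℂ) (γ : ι → ℂ) (f0 : Fin D → ℂ) (γ0 ρ : ℂ) (q : Fin D → ℂ)
    (A : ι → Fin D → ℂ) (μ : ι → ℂ) (A0 : Fin D → ℂ) (μ0 : ℂ) (φ : Fin D → ℂ) (c : ℂ) :
    ArrowSolves0 F0 f γ f0 γ0 ρ q A μ A0 μ0 φ c ↔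
      φ = phi0 F0 f0 ∧ c = cee0 F0 γ0 ∧ A = Ablk F0.toFibre f γ (phi0 F0 f0) (cee0 F0 γ0) ∧ μ = mublk F0.toFibre f (phi0 F0 f0)
        ∧ A0 = Azero F0 f γ f0 γ0 q ∧ μ0 = muzero F0 f f0 ρ := by
  constructor
  · rintro ⟨hEL, hG, hE0, hG0, hM, hQ⟩
    have hφ : φ = phi0 F0 f0 := by
      funext κ
      simp only [phi0]
      rw [eq_div_iff (F0.wE0_ne κ)]
      linear_combination (-1 : ℂ) * hE0 κ
    have hc : c = cee0 F0 γ0 := by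
      simp only [cee0]
      rw [eq_div_iff F0.wG0_ne]
      linear_combination (-1 : ℂ) * hG0
    subst hφ hc
    have hA : A = Ablk F0.toFibre f γ (phi0 F0 f0) (cee0 F0 γ0) := funext fun m => (block_unique F0.toFibre hEL hG m).2
    have hμ : μ = mublk F0.toFibre f (phi0 F0 f0) := funext fun m => (block_unique F0.toFibre hEL hG m).1
    subst hA hμ
    refine ⟨rfl, rfl, rfl, rfl, funext fun κ => ?_, ?_⟩
    · simp only [Azero]
      rw [eq_div_iff (F0.wQ0_ne κ)]
      linear_combination hQ κ
    · simp only [muzero]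
      rw [eq_div_iff F0.wM0_ne]
      linear_combination hM
  · rintro ⟨rfl, rfl, rfl, rfl, rfl, rfl⟩
    refine ⟨elRows_Ablk F0.toFibre f γ _ _, gRows_Ablk F0.toFibre f γ _ _, fun κ => ?_, ?_, ?_, fun κ => ?_⟩
    · simp only [phi0]; field_simp [F0.wE0_ne κ]
    · simp only [cee0]; field_simp [F0.wG0_ne]
    · simp only [muzero]; field_simp [F0.wM0_ne]; ring
    · simp only [Azero]; field_simp [F0.wQ0_ne κ]; ring

/-- [folklore] The zero alias's field in capacitance vocabulary: `wQ⁰_κ A⁰_κ = q_κ − srcQ κ − Σ_l capP κ l φ_l − capV κ c` at `(φ, c) = (phi0, cee0)`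
(`sum_wQ_Ablk`) — the same alias sums as at `p ≠ 0`, now on the right-hand side. -/
theorem wQ0_mul_Azero [Fintype ι] (f : ι → Fin D → ℂ) (γ : ι → ℂ) (f0 : Fin D → ℂ) (γ0 : ℂ) (q : Fin D → ℂ) (κ : Fin D) :
    F0.wQ0 κ * Azero F0 f γ f0 γ0 q κ
      = q κ - srcQ F0.toFibre f γ κ - ∑ l, capP F0.toFibre κ l * phi0 F0 f0 l - capV F0.toFibre κ * cee0 F0 γ0 := by
  simp only [Azero]
  rw [mul_div_cancel₀ _ (F0.wQ0_ne κ), sum_wQ_Ablk]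
  ring

/-- [folklore] The zero alias's multiplier in capacitance vocabulary: `wM⁰ μ⁰ = ρ + srcM + Σ_κ capW κ φ_κ` at `φ = phi0` (`sum_wM_mublk`). -/
theorem wM0_mul_muzero [Fintype ι] (f : ι → Fin D → ℂ) (f0 : Fin D → ℂ) (ρ : ℂ) :
    F0.wM0 * muzero F0 f f0 ρ = ρ + srcM F0.toFibre f + ∑ κ, capW F0.toFibre κ * phi0 F0 f0 κ := by
  simp only [muzero]
  rw [mul_div_cancel₀ _ F0.wM0_ne, sum_wM_mublk]
  ring

end Summit.QuantumFields.BalabanUV.Beta.GAN24.CapacitanceSolveZero
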